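import Mathlib
import HarnessLib

/-!
# Chains of interior discs joining two points of a planar domain

Topic `Literature/Probability/RandomPlanarGeometry` (plane topology of domains; the continuum
half of the "Harnack chain" / corridor constructions by which positivity of a harmonic function is
transported across a domain — e.g. the a-priori lower bound in D. Chelkak, S. Smirnov,
Adv. Math. 228 (2011), proof of Thm. 3.13, or any proof of Harnack's inequality on compact subsets
of a domain).

* **`exists_chain_closedBall_subset`** — if `D ⊆ ℂ` is open and connected and `p, q ∈ D`, there
  is `ε₀ > 0` such that for every step `ℓ > 0` one finds finitely many points
  `p = z₀, z₁, …, z_J = q` with all closed discs `closedBall z_j ε₀ ⊆ D` and consecutive points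
  at distance `≤ ℓ` (a path from `p` to `q`, the positive distance of its compact trace to `Dᶜ`,
  and uniform continuity).

Everything is proved, [folklore].
-/

noncomputable section

namespace Literature.Probability.RandomPlanarGeometry

open Metric Set Filter _root_.Topology

/-- **A chain of interior discs joining two points of a domain.** For `D` open and connected and
`p, q ∈ D` there is `ε₀ > 0` such that for every `ℓ > 0` there are `J` and points `z 0 = p`,
`z J = q` with `closedBall (z j) ε₀ ⊆ D` for `j ≤ J` and `dist (z (j+1)) (z j) ≤ ℓ` for `j < J`.
[folklore] -/
theorem exists_chain_closedBall_subset {D : Set ℂ} (hD : IsOpen D) (hDc : IsConnected D)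
    {p q : ℂ} (hp : p ∈ D) (hq : q ∈ D) :
    ∃ ε₀ > 0, ∀ ℓ > 0, ∃ (J : ℕ) (z : ℕ → ℂ), z 0 = p ∧ z J = q ∧
      (∀ j, j ≤ J → closedBall (z j) ε₀ ⊆ D) ∧ (∀ j, j < J → dist (z (j + 1)) (z j) ≤ ℓ) := by
  -- a path from `p` to `q` inside `D`
  have hpc : IsPathConnected D := (hD.isConnected_iff_isPathConnected).1 hDc
  obtain ⟨γ, hγ⟩ := hpc.joinedIn p hp q hq
  -- its trace is compact, at positive distance from `Dᶜ`
  have hK : IsCompact (range γ) := isCompact_range γ.continuous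
  have hKD : range γ ⊆ D := by rintro _ ⟨t, rfl⟩; exact hγ t
  obtain ⟨ε₀, hε₀, hthick⟩ := hK.exists_cthickening_subset_open hD hKD
  refine ⟨ε₀, hε₀, fun ℓ hℓ => ?_⟩
  -- uniform continuity of the extended path on `[0, 1]`
  have huc : UniformContinuousOn γ.extend (Icc (0 : ℝ) 1) :=
    isCompact_Icc.uniformContinuousOn_of_continuous γ.continuous_extend.continuousOn
  obtain ⟨η, hη, hηuc⟩ := Metric.uniformContinuousOn_iff.1 huc ℓ hℓ
  -- the subdivision
  set J := ⌈1 / η⌉₊ + 1 with hJ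
  have hJ0 : 0 < J := Nat.succ_pos _
  have hJr : (0 : ℝ) < J := by exact_mod_cast hJ0
  have hJη : 1 / (J : ℝ) < η := by
    rw [div_lt_iff₀ hJr]
    have h1 : 1 / η ≤ ⌈1 / η⌉₊ := Nat.le_ceil _
    have h2 : (J : ℝ) = ⌈1 / η⌉₊ + 1 := by rw [hJ]; push_cast; ring
    rw [h2]
    have := (div_le_iff₀ hη).1 h1
    nlinarith
  set z : ℕ → ℂ := fun j => γ.extend ((j : ℝ) / J) with hz
  have hmem : ∀ j, j ≤ J → ((j : ℝ) / J) ∈ Icc (0 : ℝ) 1 := by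
    intro j hj
    refine ⟨div_nonneg (Nat.cast_nonneg _) hJr.le, ?_⟩
    rw [div_le_one hJr]; exact_mod_cast hj
  refine ⟨J, z, ?_, ?_, ?_, ?_⟩
  · simp [hz]
  · simp only [hz, div_self hJr.ne']
    exact γ.extend_one
  · intro j hj
    have hzj : z j ∈ range γ := by
      rw [← γ.extend_range]
      exact mem_range_self _
    exact (closedBall_subset_cthickening hzj ε₀).trans hthick
  · intro j hj
    have h1 := hmem j hj.le
    have h2 := hmem (j + 1) hj
    have hd : dist (((j + 1 : ℕ) : ℝ) / J) ((j : ℝ) / J) < η := by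
      rw [Real.dist_eq]
      have : ((j + 1 : ℕ) : ℝ) / J - (j : ℝ) / J = 1 / J := by push_cast; ring
      rw [this, abs_of_pos (by positivity)]
      exact hJη
    exact (hηuc _ h2 _ h1 hd).le

end Literature.Probability.RandomPlanarGeometry
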